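import Summits.AtomisticToContinuum.Crystallization.Theorems.ContactSaturationLadderToleranceFloorLemmaA

/-!
# ContactSaturationLadderToleranceFloor — part B (§2–§5): the FLOOR-7/10 TOLERANCE LADDER beneath the residual `NoLooseChunks` of crux
# `LooseTextureRung` (helper, supports item 30303)

lens-1 g31 land twin (sha256 07d5e41e…), §2–§5 VERBATIM (namespace unchanged); §1 LEMMA A is part A
(`ContactSaturationLadderToleranceFloorLemmaA.lean`, imported here).  Split at the 400-line cap by hand-2 g8 (critic row 405 (5)).
The twin's module text:

# ContactSaturationLadderToleranceFloor — GRADED COMPRESSION EXCLUSION in Lennard-Jones ground states and the FLOOR-7/10 TOLERANCE LADDER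
beneath the residual `NoLooseChunks` of crux `LooseTextureRung` (helper, supports item 30303)

Helper for route `ContactSaturationLadder` (sub-problem `Crystallization`), crux `LooseTextureRung` (stmt-AtomisticToContinuum-30303,
DECLARED RESIDUAL-CORE), registered line «DialFreeSieveV6» v6.3 (lens-1 lineage `decomp-a2c-lens-1`, cell `decomp-a2c`; the registered skeleton and
its stubs are UNTOUCHED — nothing here is a registered item).  Source: the lineage node g31 (`LooseTextureRung_node_g31.lean`, §41 `FloorRebase41`,
kernel-checked there against the tree item); landing asked by the cell critic (CRITIC-LEDGER row 398 (i): «land the top-rung kernels of the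
tolerance ladder as a def-light helper»).  Every statement below is PROVED (0 sorry, standard axioms).

## What is proved

§1 **LEMMA A — graded compression exclusion (DEF-FREE).**  `card_within_lt_of_capacity`: in a Lennard-Jones ground state, for `ρ ≤ 1` and
   `n·(ρ⁻¹² − 2ρ⁻⁶) > (84/25)/(7/20)³ − 1 ≈ 77.37`, FEWER THAN `n` other particles lie within distance `ρ` of any particle; grades
   `< 12` within `4/5`, `< 8` within `39/50`, `< 4` within `3/4`, `< 3` within `18/25`; and `four_fifths_lt_of_twelve_contacts`: twelve particles
   within `(1+δ)·d` of a ground-state particle force `(1+δ)·d > 4/5`.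
   Proof (removal + charged capacity, all inputs in the tree): `LjLaminarWindowsSketch.forceBalance_one_le_sum_hLJ` gives
   `∑_{k≠j} h(|y_j−y_k|) ≥ 1` (`h = hLJ = −12·V_LJ`); the `k` within `ρ` contribute `≤ h(ρ) = 2ρ⁻⁶ − ρ⁻¹² < 0` each (`h` increases on `(0,1]`),
   the rest `≤ ∑ kF ≤ (84/25)/(7/20)³` by `ForceCapacity` (`stub_forceCapacity stub_forceTheta stub_forceClubsuit`) at `c = 7/20`, admissible
   because ground states are `7/10`-separated (`lennardJones_groundState_dist_ge_seven_tenths`).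
§2 **The floor variable.**  `UniformlyTightF δ d y j` = `ContactSaturationLadderHaloCount.UniformlyTight δ d y j` with the admissible common
   scale widened from `[3/4, 6/5]` to `[7/10, 6/5]` (floor = the tree's separation), `looseSetF δ y` its loose set; `looseSetF ⊆ looseSet`
   (formal) and, by Lemma A, `looseSetF δ y = looseSet δ y` on ground states for `δ ≤ 1/15` (`looseSetF_eq_looseSet_gs`).
§3 **The floor-7/10 ladder.**  `NoLooseChunkAtF δ r` / `NoLooseChunksF δ` (the tree rung `ContactSaturationLadderChunkDoor.NoLooseChunkAt` /
   `NoLooseChunks` at tolerance `δ` on `looseSetF`), the band pieces `BandChunkAtF δ₁ δ₂ ρ' r` / `BandExclusionF δ₁ δ₂`; the REBASE PIN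
   `noLooseChunksF_base_iff_tree : NoLooseChunksF (3/50) ↔ NoLooseChunks`; monotonicity in `δ`; the band kernel (recentring dichotomy) and the
   EXACT band split `NoLooseChunksF δ₁ ↔ NoLooseChunksF δ₂ ∧ BandExclusionF δ₁ δ₂` (`δ₁ ≤ δ₂`).
§4 **The top is a theorem.**  `noLooseChunksF_top : 7/2 ≤ (1+δ)·(7/10) → NoLooseChunksF δ` (tree separation + density floor
   `ContactSaturationLadderDensityFloor.card_window_ge_of_not_voidAdj`).
§5 **The exact cut.**  `noLooseChunks_iff_ladderF : NoLooseChunks ↔ BandExclusionF (3/50) (3/20) ∧ BandExclusionF (3/20) (1/4) ∧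
   BandExclusionF (1/4) (1/2) ∧ BandExclusionF (1/2) 4` — the residual as FOUR pieces, each certified WEAKER than it by name
   (`bandExclusionF_of_noLooseChunks`), with no separation hypothesis.
-/

noncomputable section

namespace Summit.AtomisticToContinuum.Crystallization.Theorems.ContactSaturationLadderToleranceFloor

open scoped BigOperators Classical
open Metric
open Literature.MathematicalPhysics.StatisticalMechanics (lennardJones IsGroundState)
open Literature.MathematicalPhysics.StatisticalMechanics.Yuhjtman2015 (hLJ)
open Summit.AtomisticToContinuum.Crystallization.Theorems
open Summit.AtomisticToContinuum.Crystallization.Theorems.ContactSaturationLadderHaloCount (UniformlyTight looseSet voidAdjSet)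
open Summit.AtomisticToContinuum.Crystallization.Theorems.ContactSaturationLadderChunkDoor (NoLooseChunkAt NoLooseChunks)
open Summit.AtomisticToContinuum.Crystallization.Theorems.ContactSaturationLadderDensityFloor (card_window_ge_of_not_voidAdj)
open Summit.AtomisticToContinuum.Crystallization.Theorems.LjLaminarWindowsSketch (hLJ' kF ForceCapacity stub_forceCapacity
  stub_forceTheta stub_forceClubsuit forceBalance_one_le_sum_hLJ lennardJones_groundState_dist_ge_seven_tenths)

/-! ## §2 The floor variable: uniform tightness with admissible-scale floor `7/10` -/

/-- **`UniformlyTightF δ d y j`** — `ContactSaturationLadderHaloCount.UniformlyTight δ d y j` with the admissible common scale widened to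
`d ∈ [7/10, 6/5]` (floor = the tree's ground-state separation `7/10`; separation and twelve-contact clauses verbatim). -/
def UniformlyTightF (δ d : ℝ) {N : ℕ} (y : Fin N → EuclideanSpace ℝ (Fin 3)) (j : Fin N) : Prop :=
  7 / 10 ≤ d ∧ d ≤ 6 / 5 ∧ (∀ k l : Fin N, k ≠ l → dist (y k) (y j) ≤ 6 → dist (y l) (y j) ≤ 6 → d ≤ dist (y k) (y l)) ∧
    (∀ k : Fin N, dist (y k) (y j) ≤ 5 → 12 ≤ (Finset.univ.filter fun l => l ≠ k ∧ dist (y l) (y k) ≤ (1 + δ) * d).card)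

/-- The `δ`-LOOSE particles for the floor-`7/10` notion: no uniformly `δ`-tight 5-ball at ANY scale `d ∈ [7/10, 6/5]`. -/
def looseSetF (δ : ℝ) {N : ℕ} (y : Fin N → EuclideanSpace ℝ (Fin 3)) : Finset (Fin N) :=
  Finset.univ.filter fun j : Fin N => ∀ d : ℝ, ¬ UniformlyTightF δ d y j

/-- Tight at floor 3/4 ⟹ tight at floor 7/10 (formal). -/
theorem uniformlyTightF_of_uniformlyTight {δ d : ℝ} {N : ℕ} {y : Fin N → EuclideanSpace ℝ (Fin 3)} {j : Fin N}
    (h : UniformlyTight δ d y j) : UniformlyTightF δ d y j := by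
  unfold UniformlyTight at h
  obtain ⟨hd1, hd2, hsep, hcoord⟩ := h
  exact ⟨by linarith, hd2, hsep, hcoord⟩

/-- `looseSetF δ ⊆ looseSet δ` (formal). -/
theorem looseSetF_subset_looseSet (δ : ℝ) {N : ℕ} (y : Fin N → EuclideanSpace ℝ (Fin 3)) : looseSetF δ y ⊆ looseSet δ y := by
  intro j hj
  simp only [looseSetF, looseSet, Finset.mem_filter, Finset.mem_univ, true_and] at hj ⊢
  exact fun d hT => hj d (uniformlyTightF_of_uniformlyTight hT)

/-- **The floor is immaterial in ground states at slack `δ ≤ 1/15` (Lemma A).**  A uniformly `δ`-tight 5-ball at a scale `d ∈ [7/10, 6/5]` has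
`d ≥ 3/4`: twelve contacts within `(1+δ)·d ≤ (16/15)·d` force `(16/15)·d > 4/5`. -/
theorem uniformlyTight_of_uniformlyTightF_gs {δ d : ℝ} (hδ : δ ≤ 1 / 15) {N : ℕ} {y : Fin N → EuclideanSpace ℝ (Fin 3)}
    (hy : IsGroundState lennardJones y) {j : Fin N} (h : UniformlyTightF δ d y j) : UniformlyTight δ d y j := by
  obtain ⟨hd1, hd2, hsep, hcoord⟩ := h
  unfold UniformlyTight
  refine ⟨?_, hd2, hsep, hcoord⟩
  have h12 := hcoord j (by rw [dist_self]; norm_num)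
  have h45 := four_fifths_lt_of_twelve_contacts hy h12
  nlinarith

/-- On ground states the two loose sets COINCIDE for `δ ≤ 1/15` (in particular at the crux's grade `3/50`). -/
theorem looseSetF_eq_looseSet_gs {δ : ℝ} (hδ : δ ≤ 1 / 15) {N : ℕ} {y : Fin N → EuclideanSpace ℝ (Fin 3)}
    (hy : IsGroundState lennardJones y) : looseSetF δ y = looseSet δ y := by
  refine Finset.Subset.antisymm (looseSetF_subset_looseSet δ y) fun j hj => ?_
  simp only [looseSetF, looseSet, Finset.mem_filter, Finset.mem_univ, true_and] at hj ⊢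
  exact fun d hT => hj d (uniformlyTight_of_uniformlyTightF_gs hδ hy hT)

/-- Monotonicity in the slack. -/
theorem uniformlyTightF_mono_slack {δ δ' d : ℝ} (hδ : δ ≤ δ') {N : ℕ} {y : Fin N → EuclideanSpace ℝ (Fin 3)} {j : Fin N}
    (h : UniformlyTightF δ d y j) : UniformlyTightF δ' d y j := by
  obtain ⟨hd1, hd2, hsep, hcoord⟩ := h
  refine ⟨hd1, hd2, hsep, fun k hk => le_trans (hcoord k hk) (Finset.card_le_card ?_)⟩
  intro l hl
  simp only [Finset.mem_filter, Finset.mem_univ, true_and] at hl ⊢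
  have hd0 : 0 ≤ d := le_trans (by norm_num) hd1
  exact ⟨hl.1, le_trans hl.2 (by nlinarith)⟩

/-- The floor-7/10 loose sets are ANTITONE in the slack. -/
theorem looseSetF_anti_slack {δ δ' : ℝ} (hδ : δ ≤ δ') {N : ℕ} (y : Fin N → EuclideanSpace ℝ (Fin 3)) :
    looseSetF δ' y ⊆ looseSetF δ y := by
  intro j hj
  simp only [looseSetF, Finset.mem_filter, Finset.mem_univ, true_and] at hj ⊢
  exact fun d hT => hj d (uniformlyTightF_mono_slack hδ hT)

/-! ## §3 The floor-7/10 tolerance ladder: graded rungs, band pieces, kernels -/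

/-- **NLC_F(δ) AT ONE RADIUS · `NoLooseChunkAtF δ r`** — the tree rung `ContactSaturationLadderChunkDoor.NoLooseChunkAt r` with the loose set
`looseSet (3/50)` replaced by `looseSetF δ`: no Lennard-Jones ground state has a 2-void-free doubled window `B(c,2r)` all of whose particles are
floor-7/10 `δ`-loose and whose inner window `B(c,r)` holds a particle. -/
def NoLooseChunkAtF (δ r : ℝ) : Prop :=
  ∀ (N : ℕ) (y : Fin N → EuclideanSpace ℝ (Fin 3)), IsGroundState lennardJones y →
    ∀ c : EuclideanSpace ℝ (Fin 3),
      (∀ i : Fin N, dist (y i) c ≤ 2 * r → i ∈ looseSetF δ y) →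
        (∀ i : Fin N, dist (y i) c ≤ 2 * r → i ∉ voidAdjSet 2 y) → ∀ i : Fin N, r < dist (y i) c

/-- **NLC_F(δ) · `NoLooseChunksF δ`** — «no floor-7/10 `δ`-loose chunks», eventually in the radius. -/
def NoLooseChunksF (δ : ℝ) : Prop :=
  ∃ ρ₀ : ℝ, ∀ ρ : ℝ, ρ₀ ≤ ρ → NoLooseChunkAtF δ ρ

/-- NLC_F(3/50) at one radius is WEAKER than the tree rung (formal: an all-`looseSetF` chunk is an all-`looseSet` chunk). -/
theorem noLooseChunkAtF_of_noLooseChunkAt {r : ℝ} (h : NoLooseChunkAt r) : NoLooseChunkAtF (3 / 50) r :=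
  fun N y hy c hl hv => h N y hy c (fun i hi => looseSetF_subset_looseSet (3 / 50) y (hl i hi)) hv

/-- **REBASE KERNEL (Lemma A)**: the floor-7/10 rung at tolerance `3/50` IS the tree rung, one radius. -/
theorem noLooseChunkAtF_iff_noLooseChunkAt (r : ℝ) : NoLooseChunkAtF (3 / 50) r ↔ NoLooseChunkAt r := by
  refine ⟨fun h N y hy c hl hv => h N y hy c (fun i hi => ?_) hv, noLooseChunkAtF_of_noLooseChunkAt⟩
  rw [looseSetF_eq_looseSet_gs (by norm_num) hy]
  exact hl i hi

/-- **REBASE PIN**: `NoLooseChunksF (3/50) ↔ ContactSaturationLadderChunkDoor.NoLooseChunks`. -/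
theorem noLooseChunksF_base_iff_tree : NoLooseChunksF (3 / 50) ↔ NoLooseChunks := by
  constructor
  · rintro ⟨ρ₀, h₀⟩
    exact ⟨ρ₀, fun ρ hρ => (noLooseChunkAtF_iff_noLooseChunkAt ρ).mp (h₀ ρ hρ)⟩
  · rintro ⟨ρ₀, h₀⟩
    exact ⟨ρ₀, fun ρ hρ => (noLooseChunkAtF_iff_noLooseChunkAt ρ).mpr (h₀ ρ hρ)⟩

/-- MONOTONICITY IN THE GRADE, one radius. -/
theorem noLooseChunkAtF_mono {δ δ' r : ℝ} (hδ : δ ≤ δ') (h : NoLooseChunkAtF δ r) : NoLooseChunkAtF δ' r :=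
  fun N y hy c hl hv => h N y hy c (fun i hi => looseSetF_anti_slack hδ y (hl i hi)) hv

/-- MONOTONICITY IN THE GRADE: `NoLooseChunksF δ → NoLooseChunksF δ'` for `δ ≤ δ'`. -/
theorem noLooseChunksF_mono {δ δ' : ℝ} (hδ : δ ≤ δ') (h : NoLooseChunksF δ) : NoLooseChunksF δ' := by
  obtain ⟨ρ₀, h₀⟩ := h
  exact ⟨ρ₀, fun ρ hρ => noLooseChunkAtF_mono hδ (h₀ ρ hρ)⟩

/-- NLC_F at any grade `δ ≥ 3/50` is WEAKER than the residual NLC (certified by name). -/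
theorem noLooseChunksF_of_noLooseChunks {δ : ℝ} (hδ : 3 / 50 ≤ δ) (h : NoLooseChunks) : NoLooseChunksF δ :=
  noLooseChunksF_mono hδ (noLooseChunksF_base_iff_tree.mpr h)

/-- **BAND PIECE AT ONE RADIUS · `BandChunkAtF δ₁ δ₂ ρ' r`**: no Lennard-Jones ground state has an all-`δ₁`-looseF, 2-void-free doubled window
`B(c,2r)` with occupied inner window IN WHICH THE NOT-`δ₂`-looseF PARTICLES ARE `2ρ'`-DENSE: every sub-window `B(c',2ρ')` with
`dist c' c ≤ 2r − 2ρ'` whose inner ball `B(c',ρ')` holds a particle contains a particle outside `looseSetF δ₂`. -/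
def BandChunkAtF (δ₁ δ₂ ρ' r : ℝ) : Prop :=
  ∀ (N : ℕ) (y : Fin N → EuclideanSpace ℝ (Fin 3)), IsGroundState lennardJones y →
    ∀ c : EuclideanSpace ℝ (Fin 3),
      (∀ i : Fin N, dist (y i) c ≤ 2 * r → i ∈ looseSetF δ₁ y) →
        (∀ i : Fin N, dist (y i) c ≤ 2 * r → i ∉ voidAdjSet 2 y) →
          (∀ c' : EuclideanSpace ℝ (Fin 3), dist c' c ≤ 2 * r - 2 * ρ' → (∃ i : Fin N, dist (y i) c' ≤ ρ') →
              ∃ j : Fin N, dist (y j) c' ≤ 2 * ρ' ∧ j ∉ looseSetF δ₂ y) →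
            ∀ i : Fin N, r < dist (y i) c

/-- **BAND_F(δ₁,δ₂) · `BandExclusionF δ₁ δ₂`** — «no large all-`δ₁`-looseF void-free ground-state chunks with dense `δ₂`-tightF particles», for
EVERY density radius `ρ' ≥ 0`, eventually in the chunk radius. -/
def BandExclusionF (δ₁ δ₂ : ℝ) : Prop :=
  ∀ ρ' : ℝ, 0 ≤ ρ' → ∃ r₀ : ℝ, ∀ r : ℝ, r₀ ≤ r → BandChunkAtF δ₁ δ₂ ρ' r

/-- A band piece is WEAKER than NLC_F at its lower grade (it excludes a SUB-class of the same chunks). -/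
theorem bandExclusionF_of_noLooseChunksF {δ₁ δ₂ : ℝ} (h : NoLooseChunksF δ₁) : BandExclusionF δ₁ δ₂ := by
  obtain ⟨ρ₀, h₀⟩ := h
  exact fun ρ' _ => ⟨ρ₀, fun r hr N y hy c hl hv _ => h₀ r hr N y hy c hl hv⟩

/-- Every band piece above the crux's grade is WEAKER than the residual NLC (certified by name). -/
theorem bandExclusionF_of_noLooseChunks {δ₁ δ₂ : ℝ} (hδ : 3 / 50 ≤ δ₁) (h : NoLooseChunks) : BandExclusionF δ₁ δ₂ :=
  bandExclusionF_of_noLooseChunksF (noLooseChunksF_of_noLooseChunks hδ h)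

/-- **THE BAND KERNEL (recentring dichotomy; no order between `δ₁` and `δ₂` needed)**: NLC_F(δ₂) ∧ BAND_F(δ₁,δ₂) ⟹ NLC_F(δ₁).  Given a large
all-`δ₁`-looseF void-free chunk, either some `2ρ'`-sub-window with occupied inner ball has NO particle outside `looseSetF δ₂` — an all-`δ₂`-looseF
void-free chunk of radius `ρ'`, excluded by NLC_F(δ₂) — or those particles are `2ρ'`-dense and BAND_F excludes the chunk. -/
theorem noLooseChunksF_of_band {δ₁ δ₂ : ℝ} (hN : NoLooseChunksF δ₂) (hB : BandExclusionF δ₁ δ₂) : NoLooseChunksF δ₁ := by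
  obtain ⟨ρ₂, h₂⟩ := hN
  obtain ⟨r₀, hr₀⟩ := hB (max ρ₂ 0) (le_max_right _ _)
  refine ⟨r₀, fun r hr N y hy c hl hv => hr₀ r hr N y hy c hl hv ?_⟩
  intro c' hc' hocc
  by_contra hno
  push Not at hno
  have hch : ∀ i : Fin N, max ρ₂ 0 < dist (y i) c' :=
    h₂ (max ρ₂ 0) (le_max_left _ _) N y hy c' (fun j hj => hno j hj) fun j hj => hv j (by
      have := dist_triangle (y j) c' c
      linarith)
  obtain ⟨i, hi⟩ := hocc
  exact absurd (hch i) (not_lt.mpr hi)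

/-- **EXACT BAND SPLIT (both directions)**: for `δ₁ ≤ δ₂`, NLC_F(δ₁) ⟺ NLC_F(δ₂) ∧ BAND_F(δ₁,δ₂). -/
theorem noLooseChunksF_iff_band {δ₁ δ₂ : ℝ} (hδ : δ₁ ≤ δ₂) :
    NoLooseChunksF δ₁ ↔ NoLooseChunksF δ₂ ∧ BandExclusionF δ₁ δ₂ :=
  ⟨fun h => ⟨noLooseChunksF_mono hδ h, bandExclusionF_of_noLooseChunksF h⟩, fun h => noLooseChunksF_of_band h.1 h.2⟩

/-! ## §4 The top of the ladder is a theorem: `(1+δ)·(7/10) ≥ 7/2` -/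

/-- **GEOMETRIC FORCING AT THE FLOOR.**  A particle whose 6-ball is `7/10`-separated and whose 12-ball is 2-void-free is uniformly `δ`-tight at
the common scale `d = 7/10` as soon as `(1+δ)·(7/10) ≥ 7/2`: the `7/2`-ball of every particle of its 5-ball holds `≥ ⌈(5/2)³⌉ = 16`
particles (density floor), hence `≥ 15 ≥ 12` OTHERS within `7/2 ≤ (1+δ)·(7/10)`. -/
theorem uniformlyTightF_sevenTenths_of_voidFree {δ : ℝ} (hδ : 7 / 2 ≤ (1 + δ) * (7 / 10)) {N : ℕ}
    {y : Fin N → EuclideanSpace ℝ (Fin 3)} {j : Fin N}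
    (hsep : ∀ k l : Fin N, k ≠ l → dist (y k) (y j) ≤ 6 → dist (y l) (y j) ≤ 6 → (7 / 10 : ℝ) ≤ dist (y k) (y l))
    (hv : ∀ i : Fin N, dist (y i) (y j) ≤ 12 → i ∉ voidAdjSet 2 y) :
    UniformlyTightF δ (7 / 10) y j := by
  refine ⟨le_rfl, by norm_num, hsep, fun k hk => ?_⟩
  set B : Finset (Fin N) := Finset.univ.filter fun i : Fin N => dist (y i) (y k) ≤ 7 / 2 with hB
  have hfloor : ((7 / 2 : ℝ) - 1) ^ 3 ≤ (B.card : ℝ) := by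
    refine card_window_ge_of_not_voidAdj y (y k) (by norm_num) ?_ ⟨k, by rw [dist_self]; norm_num⟩
    intro i hi
    have hi12 : dist (y i) (y j) ≤ 12 := by
      have := dist_triangle (y i) (y k) (y j)
      linarith
    exact hv i hi12
  norm_num at hfloor
  have h16 : 16 ≤ B.card := by
    by_contra hlt
    push Not at hlt
    have h15 : (B.card : ℝ) ≤ 15 := by exact_mod_cast Nat.lt_succ_iff.mp hlt
    linarith
  have hkB : k ∈ B := by
    rw [hB, Finset.mem_filter]
    exact ⟨Finset.mem_univ _, by rw [dist_self]; norm_num⟩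
  have hsub : B.erase k ⊆ Finset.univ.filter (fun l : Fin N => l ≠ k ∧ dist (y l) (y k) ≤ (1 + δ) * (7 / 10)) := by
    intro l hl
    rw [Finset.mem_erase] at hl
    simp only [hB, Finset.mem_filter, Finset.mem_univ, true_and] at hl ⊢
    exact ⟨hl.1, le_trans hl.2 hδ⟩
  have hcard := Finset.card_le_card hsub
  rw [Finset.card_erase_of_mem hkB] at hcard
  omega

/-- **TOP KERNEL FROM THE TREE.**  For `(1+δ)·(7/10) ≥ 7/2` and `r ≥ 12`, `NoLooseChunkAtF δ r` HOLDS: an inner particle of an all-looseF 2-void-free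
chunk has a `7/10`-separated 6-ball (tree separation) and a 2-void-free 12-ball, so it is tight at the scale `7/10` — contradiction. -/
theorem noLooseChunkAtF_top {δ : ℝ} (hδ : 7 / 2 ≤ (1 + δ) * (7 / 10)) {r : ℝ} (hr : 12 ≤ r) : NoLooseChunkAtF δ r := by
  intro N y hy c hl hv i
  by_contra hin
  rw [not_lt] at hin
  have hsep : ∀ k l : Fin N, k ≠ l → dist (y k) (y i) ≤ 6 → dist (y l) (y i) ≤ 6 → (7 / 10 : ℝ) ≤ dist (y k) (y l) :=
    fun k l hkl _ _ => lennardJones_groundState_dist_ge_seven_tenths hy hkl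
  have hvi : ∀ m : Fin N, dist (y m) (y i) ≤ 12 → m ∉ voidAdjSet 2 y := fun m hm => hv m (by
    have := dist_triangle (y m) (y i) c
    linarith)
  have htight := uniformlyTightF_sevenTenths_of_voidFree hδ hsep hvi
  have hloose := hl i (by linarith)
  simp only [looseSetF, Finset.mem_filter, Finset.mem_univ, true_and] at hloose
  exact hloose (7 / 10) htight

/-- **THE TOP OF THE FLOOR-7/10 LADDER IS A THEOREM**: `NoLooseChunksF δ` for every `δ` with `(1+δ)·(7/10) ≥ 7/2` (every `δ ≥ 4`). -/
theorem noLooseChunksF_top {δ : ℝ} (hδ : 7 / 2 ≤ (1 + δ) * (7 / 10)) : NoLooseChunksF δ :=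
  ⟨12, fun _ hr => noLooseChunkAtF_top hδ hr⟩

/-- In particular NLC_F(4), the grid's top. -/
theorem noLooseChunksF_four : NoLooseChunksF 4 := noLooseChunksF_top (by norm_num)

/-- Every band piece with lower grade at the top is a theorem. -/
theorem bandExclusionF_top {δ₁ δ₂ : ℝ} (hδ : 7 / 2 ≤ (1 + δ₁) * (7 / 10)) : BandExclusionF δ₁ δ₂ :=
  bandExclusionF_of_noLooseChunksF (noLooseChunksF_top hδ)

/-! ## §5 The exact cut of the residual into four band pieces -/

/-- **THE LADDER IS EXACT ON THE GRID** `3/50 < 3/20 < 1/4 < 1/2 < 4` (marginal · TCP · σ/open · porous-or-compressed · geometric top):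
`NoLooseChunks ↔ BAND_F(3/50,3/20) ∧ BAND_F(3/20,1/4) ∧ BAND_F(1/4,1/2) ∧ BAND_F(1/2,4)`. -/
theorem noLooseChunks_iff_ladderF :
    NoLooseChunks ↔ BandExclusionF (3 / 50) (3 / 20) ∧ BandExclusionF (3 / 20) (1 / 4) ∧ BandExclusionF (1 / 4) (1 / 2) ∧
      BandExclusionF (1 / 2) 4 := by
  rw [← noLooseChunksF_base_iff_tree, noLooseChunksF_iff_band (show (3 / 50 : ℝ) ≤ 3 / 20 by norm_num),
    noLooseChunksF_iff_band (show (3 / 20 : ℝ) ≤ 1 / 4 by norm_num), noLooseChunksF_iff_band (show (1 / 4 : ℝ) ≤ 1 / 2 by norm_num),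
    noLooseChunksF_iff_band (show (1 / 2 : ℝ) ≤ 4 by norm_num)]
  have htop : NoLooseChunksF 4 := noLooseChunksF_four
  tauto

/-- The residual `NoLooseChunks` from the four floor-7/10 band pieces ALONE. -/
theorem noLooseChunks_of_ladderF (hB₀ : BandExclusionF (3 / 50) (3 / 20)) (hB₁ : BandExclusionF (3 / 20) (1 / 4))
    (hB₂ : BandExclusionF (1 / 4) (1 / 2)) (hB₃ : BandExclusionF (1 / 2) 4) : NoLooseChunks :=
  noLooseChunks_iff_ladderF.mpr ⟨hB₀, hB₁, hB₂, hB₃⟩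

end Summit.AtomisticToContinuum.Crystallization.Theorems.ContactSaturationLadderToleranceFloor

end
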